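import Summits.QuantumAdvantage.AdviceFreeQNC0.AffBells26CubeTarget
import HarnessLib

/-!
# Q1 of the flip-cube sieve: `AffBells26.CubeIdentity` PROVED, hence Q2 `CubeConstraint` (planner qn-p1 g26, ROUND-25 §5; ask P-26 (b))

Prover seat qn-prover-3 g14.  **`cubeIdentity : CubeIdentity`** — for EVERY affine bell strategy `(β, c)` and every admissible cube
`(x, A)` with `|A| ≥ 2`:  `Σ_{S ⊆ A} #{active firing bells of x_S} ≡ Σ_{g ∈ Surv} (1 + [form β x g = c g + D_g]) (mod 2)`.

Proof (the planner's route).  `form_xS`: along the cube the linear forms move ADDITIVELY, `form β x_S g = form β x g + Σ_{a ∈ S} d_g(a)`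
(the flip pairs are disjoint and untouched by the other creations, `form_flipAt`).  The active set of `x_S` is `supp J ∖ S`
(`kline_xS`).  Swapping the two sums, a row `g ∈ supp J` contributes `#{S ⊆ A ∖ g : Σ_{a∈S} d_g(a) = c_g − form β x g}`
`= nSub (A.erase g) d_g (c_g − form)` (`AffBells24.nSub`); a row BLIND to some creation (`d_g(a) = 0`) contributes an even number
(`AffBells24.card_filter_test_even`), a row seeing every creation contributes `[c_g − form + D_g ≠ 0] ≡ 1 + [form = c_g + D_g]`
(`AffBells24.nSub_mod_two`).
**`cubeConstraintOf : CubeConstraintOf`** and **`cubeConstraint : CubeConstraint`** (Q2): the three parities Q0 (`targetFormula`),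
Q1' (`cubeTarget`), Q1 add up — a perfect strategy has `survSum ≡ 0` on every admissible cube with `|A| ≥ 2`.

WHAT THIS IS NOT: instrument for the (NP₀) rung of crux stmt-QuantumAdvantage-22907 (route DWalkThree); Q3 (`SingleSurvivorCriterion`,
`TwoSurvivorCriterion`) and THEOREM S26 are NOT proved here; separation NOT moved.
-/

namespace Summit.QuantumAdvantage.AdviceFreeQNC0

namespace AffBells26

open Finset Literature.Computability.QuantumComplexity Literature.Computability.QuantumComplexity.RingHLF
open AffBells23 AffBells24 Fib19

variable {N : ℕ}

/-! ### Linear forms move additively along the cube -/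

/-- Flipping the bits in `P` moves the form by `Σ_{i ∈ P} β_{g,i}·(1 + x_i)`. -/
theorem form_flipAt (β : Fin N → Fin N → ZMod 3) (y : Fin N → Bool) (P : Finset (Fin N)) (g : Fin N) :
    form β (flipAt y P) g = form β y g + ∑ i ∈ P, β g i * (if y i then 2 else 1) := by
  classical
  unfold form
  rw [← Finset.sum_ite_mem_eq P, ← sum_add_distrib]
  refine sum_congr rfl fun i _ => ?_
  have h3 : (3 : ZMod 3) = 0 := by decide
  by_cases hi : i ∈ P
  · rw [flipAt_apply_of_mem hi, if_pos hi]
    cases y i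
    · simp
    · simp only [Bool.not_true, Bool.false_eq_true, if_false, if_true]
      linear_combination (-(β g i)) * h3
  · rw [flipAt_apply_of_not_mem hi, if_neg hi, add_zero]

/-- One creation step of the cube. -/
theorem xS_insert {x : Fin N → Bool} {A : Finset (Fin N)} (hA : Admissible x A) {a : Fin N} (ha : a ∈ A)
    {S : Finset (Fin N)} (hS : S ⊆ A) (haS : a ∉ S) : xS x (insert a S) = flipAt (xS x S) {prv a, nxt a} := by
  unfold xS
  rw [flipSet_insert, union_comm, flipAt_flipAt_of_disjoint x (disjoint_flipSet hA ha hS haS)]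

/-- The other creations do not touch the flip pair of `a`. -/
theorem xS_apply_pair {x : Fin N → Bool} {A : Finset (Fin N)} (hA : Admissible x A) {a : Fin N} (ha : a ∈ A)
    {S : Finset (Fin N)} (hS : S ⊆ A) (haS : a ∉ S) :
    xS x S (prv a) = x (prv a) ∧ xS x S (nxt a) = x (nxt a) := by
  have hd := disjoint_flipSet hA ha hS haS
  rw [disjoint_right] at hd
  unfold xS
  exact ⟨flipAt_apply_of_not_mem (hd (by simp)), flipAt_apply_of_not_mem (hd (by simp))⟩

/-- **Additivity of the forms along an admissible cube**: `form β x_S g = form β x g + Σ_{a ∈ S} d_g(a)`. -/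
theorem form_xS (hN : 3 ≤ N) (β : Fin N → Fin N → ZMod 3) (x : Fin N → Bool) {A : Finset (Fin N)}
    (hA : Admissible x A) (g : Fin N) : ∀ S, S ⊆ A → form β (xS x S) g = form β x g + ∑ a ∈ S, d β x g a := by
  classical
  intro S
  induction S using Finset.induction_on with
  | empty =>
    intro _
    unfold xS
    rw [flipSet_empty, flipAt_empty', sum_empty, add_zero]
  | insert a S haS ih =>
    intro hsub
    have ha : a ∈ A := hsub (mem_insert_self a S)
    have hS : S ⊆ A := fun i hi => hsub (mem_insert_of_mem hi)
    obtain ⟨e1, e2⟩ := xS_apply_pair hA ha hS haS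
    rw [xS_insert hA ha hS haS, form_flipAt, ih hS, sum_insert haS, sum_pair (prv_ne_nxt hN a), e1, e2]
    unfold d
    ring

/-! ### The count, row by row -/

/-- The active firing bells of `x_S`: rows `g ∉ S` of `supp J` whose moved form hits `c_g`. -/
theorem activeOnes_xS (hN : 5 ≤ N) (β : Fin N → Fin N → ZMod 3) (c : Fin N → ZMod 3) (x : Fin N → Bool)
    (hodd : IsOdd x) {A : Finset (Fin N)} (hA : Admissible x A) {S : Finset (Fin N)} (hS : S ⊆ A) :
    activeOnes (xS x S) (affBell β c (xS x S)) =
      (univ.filter fun g : Fin N => g ∉ S ∧ kline x g = true ∧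
        form β x g + ∑ a ∈ S, d β x g a = c g).card := by
  classical
  unfold activeOnes
  congr 1
  refine filter_congr fun g _ => ?_
  rw [(kline_xS hN x hodd hA S hS).2]
  unfold affBell
  rw [decide_eq_true_eq, show (∑ i : Fin N, if xS x S i = true then β g i else 0) = form β (xS x S) g from rfl,
    form_xS (by omega) β x hA g S hS]
  by_cases hg : g ∈ S
  · rw [flipAt_apply_of_mem hg, (hA.1 g (hS hg)).2.1]
    simp [hg]
  · rw [flipAt_apply_of_not_mem hg]
    simp [hg]

/-- The contribution of one row: `#{S ⊆ A : g ∉ S, form + Σ_S d = c_g} = nSub (A ∖ g) d_g (c_g − form)` for `g ∈ supp J`, else `0`. -/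
theorem card_row (β : Fin N → Fin N → ZMod 3) (c : Fin N → ZMod 3) (x : Fin N → Bool) (A : Finset (Fin N)) (g : Fin N) :
    (A.powerset.filter fun S => g ∉ S ∧ kline x g = true ∧ form β x g + ∑ a ∈ S, d β x g a = c g).card =
      if kline x g = true then nSub (A.erase g) (fun a => d β x g a) (c g - form β x g) else 0 := by
  classical
  by_cases hg : kline x g = true
  · rw [if_pos hg]
    unfold nSub
    congr 1
    ext S
    rw [mem_filter, mem_filter, mem_powerset, mem_powerset, subset_erase]
    constructor
    · rintro ⟨h1, h2, -, h4⟩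
      exact ⟨⟨h1, h2⟩, by rw [← h4]; ring⟩
    · rintro ⟨⟨h1, h2⟩, h4⟩
      exact ⟨h1, h2, hg, by rw [h4]; ring⟩
  · rw [if_neg hg, card_eq_zero, filter_eq_empty_iff]
    intro S _ h
    exact hg h.2.1

/-- A row BLIND to one creation contributes an even number (involution `S ↦ S △ {a}`). -/
theorem nSub_even_of_blind {A : Finset (Fin N)} {g a : Fin N} (ha : a ∈ A.erase g) (γ : Fin N → ZMod 3) (hγ : γ a = 0)
    (t : ZMod 3) : nSub (A.erase g) γ t % 2 = 0 := by
  rw [← card_filter_test_eq]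
  exact card_filter_test_even γ t ha hγ

/-! ### Q1 -/

/-- **Q1, `CubeIdentity`**: `Σ_{S ⊆ A} #{active firing bells of x_S} ≡ survSum (mod 2)` for every affine bell strategy. -/
theorem cubeIdentity : CubeIdentity := by
  classical
  intro N hN β c x A hodd hA hcard
  -- swap the sums: LHS = Σ_g (row count of g)
  have hswap : (∑ S ∈ A.powerset, activeOnes (xS x S) (affBell β c (xS x S))) =
      ∑ g : Fin N, (A.powerset.filter fun S => g ∉ S ∧ kline x g = true ∧
        form β x g + ∑ a ∈ S, d β x g a = c g).card := by
    rw [sum_congr rfl fun S hS => activeOnes_xS hN β c x hodd hA (mem_powerset.1 hS)]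
    simp_rw [card_filter]
    rw [sum_comm]
  rw [hswap]
  simp_rw [card_row]
  -- both sides row by row, modulo 2
  rw [Finset.sum_ite, sum_const_zero, add_zero, Finset.sum_nat_mod]
  unfold survSum
  conv_rhs => rw [Finset.sum_nat_mod]
  -- split the active rows into survivors and blind rows
  have hSurv : Surv β x A ⊆ univ.filter fun g : Fin N => kline x g = true := by
    intro g hg
    unfold Surv at hg
    rw [mem_filter] at hg ⊢
    exact ⟨mem_univ _, hg.2.1⟩
  rw [← sum_sdiff hSurv]
  have hblind : ∀ g ∈ (univ.filter fun g : Fin N => kline x g = true) \ Surv β x A,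
      nSub (A.erase g) (fun a => d β x g a) (c g - form β x g) % 2 = 0 := by
    intro g hg
    rw [mem_sdiff, mem_filter] at hg
    obtain ⟨⟨-, hJ⟩, hns⟩ := hg
    unfold Surv at hns
    rw [mem_filter, not_and, not_and_or] at hns
    rcases hns (mem_univ _) with h | h
    · exact absurd hJ h
    · push Not at h
      obtain ⟨a, ha, hda⟩ := h
      exact nSub_even_of_blind ha (fun a => d β x g a) hda _
  rw [sum_congr rfl hblind, sum_const_zero, zero_add]
  congr 1
  refine sum_congr rfl fun g hg => ?_
  unfold Surv at hg
  rw [mem_filter] at hg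
  obtain ⟨-, hJ, hsee⟩ := hg
  have hne : (A.erase g).Nonempty := by
    rw [← card_pos, card_erase_eq_ite]
    split_ifs <;> omega
  rw [nSub_mod_two (A.erase g) hne (fun a => d β x g a) hsee (c g - form β x g)]
  unfold D
  by_cases h : form β x g = c g + ∑ a ∈ A.erase g, d β x g a
  · rw [if_pos h, if_neg (by rw [h]; intro hh; apply hh; ring)]
  · rw [if_neg h, if_pos]
    intro hh
    apply h
    linear_combination -hh

/-! ### Q2 -/

/-- **`CubeConstraintOf`**: the three parities Q0, Q1', Q1 add up to the cube constraint Q2. -/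
theorem cubeConstraintOf : CubeConstraintOf := by
  intro hQ0 hQ1' hQ1 N hN β c hperf x A hodd hA hcard
  -- Q0 on every vertex of the cube: activeOnes + target ≡ 0
  have hvert : ∀ S ∈ A.powerset,
      (activeOnes (xS x S) (affBell β c (xS x S)) + N + zeros (kline (xS x S)) + pairs2 (kline (xS x S))) % 2 = 0 := by
    intro S hS
    have hoddS := (kline_xS hN x hodd hA S (mem_powerset.1 hS)).1
    exact (hQ0 N (by omega) (xS x S) hoddS (affBell β c (xS x S))).1 (hperf (xS x S) hoddS)
  have hzero : ∀ S ∈ A.powerset, (activeOnes (xS x S) (affBell β c (xS x S)) +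
      (N + zeros (kline (xS x S)) + pairs2 (kline (xS x S)))) % 2 = 0 := by
    intro S hS
    have := hvert S hS
    omega
  have hsum : (∑ S ∈ A.powerset, (activeOnes (xS x S) (affBell β c (xS x S)) +
      (N + zeros (kline (xS x S)) + pairs2 (kline (xS x S))))) % 2 = 0 := by
    rw [Finset.sum_nat_mod, sum_eq_zero hzero]
    rfl
  rw [sum_add_distrib, Nat.add_mod, hQ1' N hN x A hodd hA hcard, add_zero, Nat.mod_mod,
    hQ1 N hN β c x A hodd hA hcard] at hsum
  exact hsum

/-- **Q2, `CubeConstraint`**: a strategy winning on every odd input has `survSum ≡ 0 (mod 2)` on every admissible cube with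
`|A| ≥ 2`. -/
theorem cubeConstraint : CubeConstraint := cubeConstraintOf targetFormula cubeTarget cubeIdentity

end AffBells26

end Summit.QuantumAdvantage.AdviceFreeQNC0
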